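import Summits.Ventures.HSemireg.WedgeHankelClassSpaceRaisingShearFlags
import Mathlib.Algebra.Group.ForwardDiff

/-!
# Venture HSemireg — SAME JORDAN TYPE, DIFFERENT FLAGS, EVERY POWER: in characteristic `p`, for `λ ≠ 0` and EVERY `1 ≤ j ≤ p − 1`,
# **`ker e^j = ker (S_λ − 1)^j` if and only if `n ≤ 2p − 2`** — the threshold of M6 (`j = 1`) does not move with `j`; the witness is the spike `E_{p−j}`
# (killed by `e^j`, while the `E_{2p−1}`-coordinate of `(S_λ − 1)^j E_{p−j}` is `C(2p−1, p−j) · j! · λ^{p+j−1}`, a unit); for `j ≥ p` both kernels are everything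

HONEST FRAMING. Part of the Lean index of the computation cell `pub-hsemireg` (seat p10 gen 25, Sunday typer «UNIFORM-IN-n»).
Finite-dimensional linear algebra of endomorphisms of th-7's class space + forward differences of the powers `r ↦ r^d` at `0` + Lucas' congruence (one step) + Fermat's
little theorem on the prime field ONLY: no variety, no cohomology theory, no sheaf, no Ext group, no semiregularity map; nothing here says that HC / HC_CM / HC_AV holds; no
Literature fact is declared or used.  Custodian versions as in `WedgeHankelSiegelIdeal` (1/3) and `WedgeHankelFrameChange`; the dictionary (`e` = the infinitesimal shear on `Sym^n`,
`S_λ = SbC(1 λ 0 1)` = the substitution `Θ ↦ Θ + λ`) is QUOTED, never asserted.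

WHAT IS IN THE TREE.  M6 (`WedgeHankelClassSpaceRaisingShearFlags`): the case `j = 1` (`ker e = ker (S_λ − 1) ↔ n ≤ 2p − 2`, witness `E_{p−1}`); L6 `ker_pow_raising_eq_span` (`ker e^j` is
spanned by the spikes `E_i` with `n < i + j` or `(i+1)⋯(i+j) = 0`), `ascFactorial_succ_cast_eq_zero_iff_charP` (`⇔ p ≤ i mod p + j`), `finrank_ker_pow_raising_eq_finrank_ker_pow_shear_charP`
(SAME JORDAN TYPE); K-series `SbC_shear_pow` (`S_λ^m = S_{mλ}`), `toMatrix_SbC` / `sbMat_shear_apply` (the Pascal matrix `C(a,i) λ^{a−i}`), `spikeBasis_mem_ker_SbC_shear_sub_one_pow` (top spikes),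
`SbC_shear_sub_one_pow_eq_zero_iff_char` and `raising_pow_eq_zero_iff_charP` (both nilpotency indices are `min(p, n+1)`), `factorial_cast_ne_zero_of_lt_char`; Mathlib's forward
differences `fwdDiff_iter_eq_sum_shift`, `fwdDiff_iter_pow_eq_zero_of_lt`, `fwdDiff_iter_eq_factorial`, Lucas `Choose.choose_modEq_choose_mod_mul_choose_div_nat`, `add_pow_char`.
THIS FILE (namespace `Summit.Ventures.HSemireg.Wedge.HankelFrameChange` continued; K27's hypotheses `hE hEtop` for the raising operator):
* §427 FORWARD DIFFERENCES OF THE POWERS AT ZERO: `fwdDiff_iter_pow_apply_zero_eq_sum` (`Δ^j (r^d)(0) = Σ_{m ≤ j} (−1)^{j−m} C(j,m) m^d`), `…_of_lt` (`= 0` for `d < j`),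
  `fwdDiff_iter_pow_self_apply_zero` (`= j!` for `d = j`), `natCast_pow_eq_self_charP` (`m^p = m` on naturals) and the FERMAT REDUCTION **`fwdDiff_iter_pow_apply_zero_charP`**
  (`p ≤ d ⇒ Δ^j (r^d)(0) = Δ^j (r^{d−(p−1)})(0)` in characteristic `p`).
* §428 THE COORDINATES OF `(S_λ − 1)^j` ON A SPIKE: `repr_shear_spikeBasis` (`repr (S_μ E_i) a = C(a,i) μ^{a−i}`), `X_sub_one_pow_eq_sum` (`(X − 1)^j` in `K[X]`),
  **`shear_sub_one_pow_eq_sum`** (`(S_λ − 1)^j = Σ_{m ≤ j} (−1)^{j−m} C(j,m) • S_{mλ}` via `Polynomial.aeval`), **`repr_shear_sub_one_pow_spikeBasis`**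
  (**`repr ((S_λ − 1)^j E_i) a = C(a,i) · λ^{a−i} · Δ^j (r^{a−i})(0)`**, every field).
* §429 CHARACTERISTIC `p`: `choose_cast_eq_zero_of_lt_add_charP` (`C(a,i) = 0` for `i < p ≤ a < i + p`), `choose_two_mul_pred_cast_ne_zero_of_lt_charP` (`C(2p−1, i) ≠ 0` for `i < p`),
  **`shear_sub_one_pow_spikeBasis_eq_zero_of_le`** (`n ≤ 2p − 2`, `p ≤ i mod p + j ⇒ (S_λ − 1)^j E_i = 0`: degree, Lucas, Fermat), **`repr_shear_sub_one_pow_spikeBasis_two_mul_pred`**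
  (the `E_{2p−1}`-coordinate of `(S_λ − 1)^j E_{p−j}` is `C(2p−1, p−j) λ^{p+j−1} j!`) `…_ne_zero`, `spikeBasis_notMem_ker_shear_sub_one_pow`; then with `hE hEtop`:
  `spikeBasis_mem_ker_pow_raising_of_add_eq` (`E_{p−j} ∈ ker e^j`), `ker_pow_raising_le_ker_shear_sub_one_pow_of_le` / **`ker_pow_raising_eq_ker_shear_sub_one_pow_of_le`**
  (`n ≤ 2p − 2 ⇒ ker e^j = ker (S_λ − 1)^j` for EVERY `j`), `not_ker_pow_raising_le_ker_shear_sub_one_pow`, `not_ker_shear_sub_one_pow_le_ker_pow_raising`,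
  `ker_pow_raising_ne_ker_shear_sub_one_pow_of_ge` (`n ≥ 2p − 1`, `1 ≤ j < p`: neither kernel contains the other), **`ker_pow_raising_eq_ker_shear_sub_one_pow_iff`**
  (`1 ≤ j < p`: `ker e^j = ker (S_λ − 1)^j ↔ n ≤ 2p − 2`), `ker_pow_raising_eq_top_of_prime_le` / `ker_shear_sub_one_pow_eq_top_of_prime_le` (`p ≤ j`: both `⊤`), and the complete
  answer **`ker_pow_raising_eq_ker_shear_sub_one_pow_iff'`: `ker e^j = ker (S_λ − 1)^j ↔ j = 0 ∨ p ≤ j ∨ n ≤ 2p − 2`**.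
READING: M6's «same Jordan type, different flags» holds power by power with ONE threshold: below `n = 2p − 1` every kernel flag member of `e` IS the corresponding member for the
shear; from `n = 2p − 1` on, every proper member (`1 ≤ j ≤ p − 1`) differs, with the spike `E_{p−j}` as witness — the coefficient `Σ_m (−1)^{j−m} C(j,m) m^{p+j−1}` reduces by Fermat to
`Σ_m (−1)^{j−m} C(j,m) m^j = j!`.  Nothing Ext-side.  New names only.
-/

open Module fwdDiff

namespace Summit.Ventures.HSemireg.Wedge.HankelFrameChange

open Summit.Ventures.HSemireg.Wedge Summit.Ventures.HSemireg.Wedge.Kunneth Summit.Ventures.HSemireg.Wedge.Hankel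
  Summit.Ventures.HSemireg.Wedge.BasisFree Summit.Ventures.HSemireg.Wedge.HankelSiegel Summit.Ventures.HSemireg.Wedge.HankelSiegelIdeal
  Summit.Ventures.HSemireg.Wedge.KunnethKernel Summit.Ventures.HSemireg.Wedge.HankelRankOne Summit.Ventures.HSemireg.Wedge.KernelDuality

variable (K : Type*) [Field K] {n : ℕ}

/-! ## §427. Forward differences of the powers at zero -/

/-- **`Δ^j (r ↦ r^d) (0) = Σ_{m ≤ j} (−1)^{j−m} C(j,m) m^d`** (Mathlib's `fwdDiff_iter_eq_sum_shift` at `y = 0`, `h = 1`; over `ℚ` this is the number of surjections `[d] → [j]`). -/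
theorem fwdDiff_iter_pow_apply_zero_eq_sum (j d : ℕ) :
    (fwdDiff (1 : K))^[j] (fun r : K => r ^ d) 0 = ∑ m ∈ Finset.range (j + 1), (-1 : K) ^ (j - m) * ((j.choose m : ℕ) : K) * ((m : ℕ) : K) ^ d := by
  rw [fwdDiff_iter_eq_sum_shift]
  refine Finset.sum_congr rfl fun m _ => ?_
  rw [zero_add, nsmul_eq_mul, mul_one, zsmul_eq_mul]
  push_cast
  ring

/-- `d < j ⇒ Δ^j (r ↦ r^d) (0) = 0` (Mathlib `fwdDiff_iter_pow_eq_zero_of_lt`). -/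
theorem fwdDiff_iter_pow_apply_zero_of_lt {j d : ℕ} (h : d < j) : (fwdDiff (1 : K))^[j] (fun r : K => r ^ d) 0 = 0 := by
  rw [fwdDiff_iter_pow_eq_zero_of_lt h, Pi.zero_apply]

/-- `Δ^j (r ↦ r^j) (0) = j!` (Mathlib `fwdDiff_iter_eq_factorial`). -/
theorem fwdDiff_iter_pow_self_apply_zero (j : ℕ) : (fwdDiff (1 : K))^[j] (fun r : K => r ^ j) 0 = ((j.factorial : ℕ) : K) := by
  rw [fwdDiff_iter_eq_factorial, Pi.natCast_apply]

/-- Fermat on the prime field: **`m^p = m` in `K` for every natural `m`** (characteristic `p`; induction with `(x + 1)^p = x^p + 1`). -/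
theorem natCast_pow_eq_self_charP (p : ℕ) [Fact p.Prime] [CharP K p] (m : ℕ) : ((m : ℕ) : K) ^ p = ((m : ℕ) : K) := by
  induction m with
  | zero => rw [Nat.cast_zero, zero_pow (Fact.out : p.Prime).ne_zero]
  | succ m ih => rw [Nat.cast_succ, add_pow_char, ih, one_pow]

/-- **THE FERMAT REDUCTION: `p ≤ d ⇒ Δ^j (r ↦ r^d) (0) = Δ^j (r ↦ r^{d − (p−1)}) (0)`** in characteristic `p` (`m^d = m^{d−p} · m^p = m^{d−p+1}` on the naturals `m ≤ j`; every `j`). -/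
theorem fwdDiff_iter_pow_apply_zero_charP (p : ℕ) [Fact p.Prime] [CharP K p] (j : ℕ) {d : ℕ} (hd : p ≤ d) :
    (fwdDiff (1 : K))^[j] (fun r : K => r ^ d) 0 = (fwdDiff (1 : K))^[j] (fun r : K => r ^ (d - (p - 1))) 0 := by
  have hp := (Fact.out : p.Prime).one_lt
  rw [fwdDiff_iter_pow_apply_zero_eq_sum, fwdDiff_iter_pow_apply_zero_eq_sum]
  refine Finset.sum_congr rfl fun m _ => ?_
  have e1 : d = (d - p) + p := by omega
  have e2 : d - (p - 1) = (d - p) + 1 := by omega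
  rw [e2, pow_succ, e1, pow_add, natCast_pow_eq_self_charP K p m, Nat.add_sub_cancel]

/-! ## §428. The coordinates of `(S_λ − 1)^j` on a spike -/

/-- the spike coordinates of the shear: **`repr (S_μ E_i) a = C(a,i) μ^{a−i}`** for `i ≤ a`, else `0` (the Pascal matrix, `toMatrix_SbC` + `sbMat_shear_apply`). -/
theorem repr_shear_spikeBasis (μ : K) (i a : Fin (n + 1)) :
    (spikeBasis K n).repr (SbC K 1 μ 0 1 (spikeBasis K n i)) a = if (i : ℕ) ≤ a then ((((a : ℕ).choose (i : ℕ) : ℕ) : K) * μ ^ ((a : ℕ) - (i : ℕ))) else 0 := by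
  rw [← LinearMap.toMatrix_apply (spikeBasis K n) (spikeBasis K n), toMatrix_SbC, sbMat_shear_apply]

/-- in `K[X]`: `(X − 1)^j = Σ_{m ≤ j} C((−1)^{j−m} C(j,m)) · X^m` (the binomial theorem in the commutative ring `K[X]`). -/
theorem X_sub_one_pow_eq_sum (j : ℕ) :
    ((Polynomial.X : Polynomial K) - 1) ^ j
      = ∑ m ∈ Finset.range (j + 1), Polynomial.C ((-1 : K) ^ (j - m) * ((j.choose m : ℕ) : K)) * Polynomial.X ^ m := by
  rw [sub_eq_add_neg, add_pow]
  refine Finset.sum_congr rfl fun m _ => ?_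
  rw [map_mul, map_pow, map_neg, map_one, map_natCast]
  ring

/-- **`(S_λ − 1)^j = Σ_{m ≤ j} (−1)^{j−m} C(j,m) • S_{mλ}`** on th-7's class space (the binomial expansion through `Polynomial.aeval`, with `S_λ^m = S_{mλ}`, K-series `SbC_shear_pow`). -/
theorem shear_sub_one_pow_eq_sum (lam : K) (j : ℕ) :
    (SbC K 1 lam 0 1 (n := n) - 1) ^ j = ∑ m ∈ Finset.range (j + 1), ((-1 : K) ^ (j - m) * ((j.choose m : ℕ) : K)) • SbC K 1 (((m : ℕ) : K) * lam) 0 1 := by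
  have e1 : (SbC K 1 lam 0 1 (n := n) - 1) ^ j = Polynomial.aeval (SbC K 1 lam 0 1 (n := n)) (((Polynomial.X : Polynomial K) - 1) ^ j) := by
    rw [map_pow, map_sub, Polynomial.aeval_X, map_one]
  rw [e1, X_sub_one_pow_eq_sum, map_sum]
  refine Finset.sum_congr rfl fun m _ => ?_
  rw [map_mul, Polynomial.aeval_C, map_pow, Polynomial.aeval_X, ← Algebra.smul_def, SbC_shear_pow]

/-- **THE COORDINATES OF `(S_λ − 1)^j E_i`: `repr ((S_λ − 1)^j E_i) a = C(a,i) · λ^{a−i} · Δ^j (r ↦ r^{a−i}) (0)`** for `i ≤ a` (else `0`), every field — the expansion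
`(S_λ − 1)^j = Σ_{m ≤ j} (−1)^{j−m} C(j,m) S_{mλ}` coordinate-wise: `C(a,i) λ^{a−i} Σ_m (−1)^{j−m} C(j,m) m^{a−i}`. -/
theorem repr_shear_sub_one_pow_spikeBasis (lam : K) (j : ℕ) (i a : Fin (n + 1)) :
    (spikeBasis K n).repr (((SbC K 1 lam 0 1 - 1) ^ j) (spikeBasis K n i)) a
      = if (i : ℕ) ≤ a then ((((a : ℕ).choose (i : ℕ) : ℕ) : K) * lam ^ ((a : ℕ) - (i : ℕ)) * (fwdDiff (1 : K))^[j] (fun r : K => r ^ ((a : ℕ) - (i : ℕ))) 0) else 0 := by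
  rw [shear_sub_one_pow_eq_sum, LinearMap.sum_apply, map_sum, Finsupp.finsetSum_apply]
  simp_rw [LinearMap.smul_apply, map_smul, Finsupp.smul_apply, repr_shear_spikeBasis, smul_eq_mul]
  by_cases hia : (i : ℕ) ≤ a
  · simp_rw [if_pos hia]
    rw [fwdDiff_iter_pow_apply_zero_eq_sum, Finset.mul_sum]
    refine Finset.sum_congr rfl fun m _ => ?_
    ring
  · simp_rw [if_neg hia, mul_zero, Finset.sum_const_zero]

/-! ## §429. Characteristic `p`: the flags of `e^j` and `(S_λ − 1)^j` agree iff `n ≤ 2p − 2` -/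

/-- Lucas, one step: **`C(a, i) = 0` in characteristic `p` for `i < p ≤ a < i + p`** (`a = (1, a − p)` and `i = (0, i)` in base `p`, with `a − p < i`). -/
theorem choose_cast_eq_zero_of_lt_add_charP (p : ℕ) [Fact p.Prime] [CharP K p] {i a : ℕ} (hi : i < p) (hpa : p ≤ a) (ha : a < i + p) :
    (((a.choose i : ℕ)) : K) = 0 := by
  rw [CharP.cast_eq_zero_iff K p]
  have hp := (Fact.out : p.Prime).one_lt
  have h := (Choose.choose_modEq_choose_mod_mul_choose_div_nat (n := a) (k := i) (p := p))
  have h1 : a % p = a - p := by rw [Nat.mod_eq_sub_mod hpa, Nat.mod_eq_of_lt (by omega)]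
  have h2 : i % p = i := Nat.mod_eq_of_lt hi
  rw [h1, h2, Nat.choose_eq_zero_of_lt (by omega : a - p < i), zero_mul] at h
  exact Nat.modEq_zero_iff_dvd.mp h

/-- Lucas, one step: **`C(2p − 1, i) ≠ 0` in characteristic `p` for `i < p`** (`2p − 1 = (1, p − 1)`, `i = (0, i)` in base `p`: `C(2p−1, i) ≡ C(p−1, i) · C(1, 0)`, and `p ∤ C(p−1, i)`
because `C(p−1, i) · i! · (p−1−i)! = (p−1)!` is prime to `p`). -/
theorem choose_two_mul_pred_cast_ne_zero_of_lt_charP (p : ℕ) [Fact p.Prime] [CharP K p] {i : ℕ} (hi : i < p) :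
    ((((2 * p - 1).choose i : ℕ)) : K) ≠ 0 := by
  have hP : p.Prime := Fact.out
  have hp := hP.one_lt
  rw [Ne, CharP.cast_eq_zero_iff K p]
  have h := (Choose.choose_modEq_choose_mod_mul_choose_div_nat (n := 2 * p - 1) (k := i) (p := p))
  have h1 : (2 * p - 1) % p = p - 1 := by rw [Nat.mod_eq_sub_mod (by omega : p ≤ 2 * p - 1), Nat.mod_eq_of_lt (by omega)]; omega
  have h2 : i % p = i := Nat.mod_eq_of_lt hi
  have h3 : (2 * p - 1) / p = 1 := Nat.div_eq_of_lt_le (by omega) (by omega)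
  have h4 : i / p = 0 := Nat.div_eq_of_lt hi
  rw [h1, h2, h3, h4, Nat.choose_zero_right, mul_one] at h
  intro hdvd
  have h5 : p ∣ (p - 1).choose i := Nat.modEq_zero_iff_dvd.mp (h.symm.trans (Nat.modEq_zero_iff_dvd.mpr hdvd))
  have h6 : p ∣ (p - 1).factorial := by
    rw [← Nat.choose_mul_factorial_mul_factorial (by omega : i ≤ p - 1)]
    exact dvd_mul_of_dvd_left (dvd_mul_of_dvd_left h5 _) _
  rw [hP.dvd_factorial] at h6
  omega

/-- **`n ≤ 2p − 2` and `p ≤ i mod p + j` ⇒ `(S_λ − 1)^j E_i = 0`** (characteristic `p`, every `λ`, every `j`): the coordinate `C(a,i) λ^{a−i} Δ^j(r^{a−i})(0)` at `E_a` vanishes — for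
`a − i < j` by degree; otherwise `i < p` (else `a ≥ i + j ≥ 2p > n`), and then for `a < i + p` by Lucas (`C(a,i) = 0`) and for `a ≥ i + p` by Fermat (`Δ^j r^{a−i} = Δ^j r^{a−i−p+1}`
at `0`, of degree `a − i − p + 1 ≤ p − 1 − i < j`). -/
theorem shear_sub_one_pow_spikeBasis_eq_zero_of_le (p : ℕ) [Fact p.Prime] [CharP K p] (lam : K) {i : Fin (n + 1)} {j : ℕ} (hij : p ≤ (i : ℕ) % p + j)
    (hn : n ≤ 2 * p - 2) : ((SbC K 1 lam 0 1 - 1) ^ j) (spikeBasis K n i) = 0 := by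
  have hp := (Fact.out : p.Prime).one_lt
  apply (spikeBasis K n).repr.injective
  rw [map_zero]
  ext a
  rw [repr_shear_sub_one_pow_spikeBasis, Finsupp.coe_zero, Pi.zero_apply]
  by_cases hia : (i : ℕ) ≤ a
  · rw [if_pos hia]
    have ha := a.2
    by_cases hd : (a : ℕ) - (i : ℕ) < j
    · rw [fwdDiff_iter_pow_apply_zero_of_lt K hd, mul_zero]
    · have hi : (i : ℕ) < p := by
        by_contra hip
        have hmod : (i : ℕ) % p = (i : ℕ) - p := by rw [Nat.mod_eq_sub_mod (by omega), Nat.mod_eq_of_lt (by omega)]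
        omega
      rw [Nat.mod_eq_of_lt hi] at hij
      by_cases hap : (a : ℕ) < (i : ℕ) + p
      · rw [choose_cast_eq_zero_of_lt_add_charP K p hi (by omega) hap, zero_mul, zero_mul]
      · rw [fwdDiff_iter_pow_apply_zero_charP K p j (by omega : p ≤ (a : ℕ) - (i : ℕ)), fwdDiff_iter_pow_apply_zero_of_lt K (by omega), mul_zero]
  · rw [if_neg hia]

/-- **the `E_{2p−1}`-coordinate of `(S_λ − 1)^j E_{p−j}` is `C(2p−1, p−j) · λ^{p+j−1} · j!`** (`1 ≤ j ≤ p`, `2p − 1 ≤ n`, characteristic `p`): Fermat reduces `Δ^j r^{p+j−1}` to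
`Δ^j r^j = j!` at `0`. -/
theorem repr_shear_sub_one_pow_spikeBasis_two_mul_pred (p : ℕ) [Fact p.Prime] [CharP K p] (lam : K) {j : ℕ} (hj1 : 1 ≤ j) (hjp : j ≤ p)
    {i a : Fin (n + 1)} (hi : (i : ℕ) + j = p) (ha : (a : ℕ) + 1 = 2 * p) :
    (spikeBasis K n).repr (((SbC K 1 lam 0 1 - 1) ^ j) (spikeBasis K n i)) a = ((((2 * p - 1).choose (p - j) : ℕ)) : K) * lam ^ (p + j - 1) * ((j.factorial : ℕ) : K) := by
  have hp := (Fact.out : p.Prime).one_lt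
  rw [repr_shear_sub_one_pow_spikeBasis, if_pos (by omega), fwdDiff_iter_pow_apply_zero_charP K p j (by omega : p ≤ (a : ℕ) - (i : ℕ)),
    show (a : ℕ) - (i : ℕ) - (p - 1) = j by omega, fwdDiff_iter_pow_self_apply_zero, show (a : ℕ) - (i : ℕ) = p + j - 1 by omega,
    show (a : ℕ) = 2 * p - 1 by omega, show (i : ℕ) = p - j by omega]

/-- … and it is **non-zero** for `λ ≠ 0` and `1 ≤ j < p` (`C(2p−1, p−j)`, `λ^{p+j−1}`, `j!` are all units). -/
theorem repr_shear_sub_one_pow_spikeBasis_two_mul_pred_ne_zero (p : ℕ) [Fact p.Prime] [CharP K p] {lam : K} (hlam : lam ≠ 0) {j : ℕ} (hj1 : 1 ≤ j) (hjp : j < p)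
    {i a : Fin (n + 1)} (hi : (i : ℕ) + j = p) (ha : (a : ℕ) + 1 = 2 * p) :
    (spikeBasis K n).repr (((SbC K 1 lam 0 1 - 1) ^ j) (spikeBasis K n i)) a ≠ 0 := by
  rw [repr_shear_sub_one_pow_spikeBasis_two_mul_pred K p lam hj1 hjp.le hi ha]
  exact mul_ne_zero (mul_ne_zero (choose_two_mul_pred_cast_ne_zero_of_lt_charP K p (by omega)) (pow_ne_zero _ hlam)) (factorial_cast_ne_zero_of_lt_char K p hjp)

/-- **`n ≥ 2p − 1 ⇒ E_{p−j} ∉ ker (S_λ − 1)^j`** (`1 ≤ j < p`, `λ ≠ 0`, characteristic `p`). -/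
theorem spikeBasis_notMem_ker_shear_sub_one_pow (p : ℕ) [Fact p.Prime] [CharP K p] {lam : K} (hlam : lam ≠ 0) (hn : 2 * p - 1 ≤ n) {j : ℕ} (hj1 : 1 ≤ j) (hjp : j < p)
    {i : Fin (n + 1)} (hi : (i : ℕ) + j = p) : spikeBasis K n i ∉ LinearMap.ker ((SbC K 1 lam 0 1 - 1) ^ j) := by
  have hp := (Fact.out : p.Prime).one_lt
  intro h
  rw [LinearMap.mem_ker] at h
  have h2 := repr_shear_sub_one_pow_spikeBasis_two_mul_pred_ne_zero K p hlam hj1 hjp hi (a := ⟨2 * p - 1, by omega⟩) (by simp only; omega)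
  rw [h, map_zero, Finsupp.coe_zero, Pi.zero_apply] at h2
  exact h2 rfl

/-- `p ≤ j ⇒ ker (S_λ − 1)^j = ⊤` (`λ ≠ 0`: the nilpotency index of `S_λ − 1` is `min(p, n+1) ≤ p`). -/
theorem ker_shear_sub_one_pow_eq_top_of_prime_le (p : ℕ) [Fact p.Prime] [CharP K p] {lam : K} (hlam : lam ≠ 0) {j : ℕ} (hpj : p ≤ j) :
    LinearMap.ker ((SbC K 1 lam 0 1 (n := n) - 1) ^ j) = ⊤ := by
  rw [(SbC_shear_sub_one_pow_eq_zero_iff_char K hlam p j).mpr (le_trans (min_le_left _ _) hpj), LinearMap.ker_zero]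

section RaisingShearPow

variable {e : Module.End K (spikeSpan K n)}
  (hE : ∀ (i : Fin (n + 1)) (hi : (i : ℕ) < n), e (spikeBasis K n i) = (((i : ℕ) : K) + 1) • spikeBasis K n ⟨(i : ℕ) + 1, by omega⟩) (hEtop : e (spikeBasis K n (Fin.last n)) = 0)
include hE hEtop

omit hEtop in
/-- `E_i ∈ ker e^j` when `i + j = p ≤ n` and `1 ≤ j` (`e^j E_i = (i+1)⋯(i+j) E_{i+j}` and `p` divides the coefficient). -/
theorem spikeBasis_mem_ker_pow_raising_of_add_eq (p : ℕ) [Fact p.Prime] [CharP K p] {j : ℕ} (hj1 : 1 ≤ j) {i : Fin (n + 1)} (hi : (i : ℕ) + j = p)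
    (hin : (i : ℕ) + j ≤ n) : spikeBasis K n i ∈ LinearMap.ker (e ^ j) := by
  have hp := (Fact.out : p.Prime).one_lt
  rw [LinearMap.mem_ker, pow_raising_spikeBasis_of_le K hE i hin,
    (ascFactorial_succ_cast_eq_zero_iff_charP K p (i : ℕ) j).mpr (by rw [Nat.mod_eq_of_lt (by omega : (i : ℕ) < p)]; omega), zero_smul]

/-- **`n ≤ 2p − 2 ⇒ ker e^j ≤ ker (S_λ − 1)^j`** for EVERY `j` (characteristic `p`): `ker e^j` is spanned by the top spikes (`n < i + j`, killed by `(S_λ − 1)^j` over every field) and by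
the spikes with `p ≤ i mod p + j` (killed while `n ≤ 2p − 2`, above). -/
theorem ker_pow_raising_le_ker_shear_sub_one_pow_of_le (p : ℕ) [Fact p.Prime] [CharP K p] (lam : K) (hn : n ≤ 2 * p - 2) (j : ℕ) :
    LinearMap.ker (e ^ j) ≤ LinearMap.ker ((SbC K 1 lam 0 1 - 1) ^ j) := by
  rw [ker_pow_raising_eq_span K hE hEtop j, Submodule.span_le]
  rintro _ ⟨⟨i, hi⟩, rfl⟩
  rw [SetLike.mem_coe]
  rcases hi with hi | hi
  · exact spikeBasis_mem_ker_SbC_shear_sub_one_pow K lam hi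
  · rw [ascFactorial_succ_cast_eq_zero_iff_charP K p] at hi
    exact LinearMap.mem_ker.mpr (shear_sub_one_pow_spikeBasis_eq_zero_of_le K p lam hi hn)

/-- **`n ≤ 2p − 2 ⇒ ker e^j = ker (S_λ − 1)^j` for EVERY `j`** (`λ ≠ 0`, characteristic `p`): inclusion (above) and equal dimension (L6, same Jordan type). -/
theorem ker_pow_raising_eq_ker_shear_sub_one_pow_of_le (p : ℕ) [Fact p.Prime] [CharP K p] {lam : K} (hlam : lam ≠ 0) (hn : n ≤ 2 * p - 2) (j : ℕ) :
    LinearMap.ker (e ^ j) = LinearMap.ker ((SbC K 1 lam 0 1 - 1) ^ j) :=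
  Submodule.eq_of_le_of_finrank_eq (ker_pow_raising_le_ker_shear_sub_one_pow_of_le K hE hEtop p lam hn j)
    (finrank_ker_pow_raising_eq_finrank_ker_pow_shear_charP K hE hEtop p hlam j)

omit hEtop in
/-- **`n ≥ 2p − 1 ⇒ ¬ ker e^j ≤ ker (S_λ − 1)^j`** for `1 ≤ j < p`: the spike `E_{p−j}` lies in `ker e^j` but not in `ker (S_λ − 1)^j`. -/
theorem not_ker_pow_raising_le_ker_shear_sub_one_pow (p : ℕ) [Fact p.Prime] [CharP K p] {lam : K} (hlam : lam ≠ 0) (hn : 2 * p - 1 ≤ n) {j : ℕ} (hj1 : 1 ≤ j)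
    (hjp : j < p) : ¬ LinearMap.ker (e ^ j) ≤ LinearMap.ker ((SbC K 1 lam 0 1 - 1) ^ j) := by
  have hp := (Fact.out : p.Prime).one_lt
  intro hle
  have hmem := spikeBasis_mem_ker_pow_raising_of_add_eq K hE p hj1 (i := ⟨p - j, by omega⟩) (by simp only; omega) (by simp only; omega)
  exact spikeBasis_notMem_ker_shear_sub_one_pow K p hlam hn hj1 hjp (i := ⟨p - j, by omega⟩) (by simp only; omega) (hle hmem)

/-- **`n ≥ 2p − 1 ⇒ ¬ ker (S_λ − 1)^j ≤ ker e^j`** either (`1 ≤ j < p`; equal dimensions, L6): neither kernel contains the other. -/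
theorem not_ker_shear_sub_one_pow_le_ker_pow_raising (p : ℕ) [Fact p.Prime] [CharP K p] {lam : K} (hlam : lam ≠ 0) (hn : 2 * p - 1 ≤ n) {j : ℕ} (hj1 : 1 ≤ j)
    (hjp : j < p) : ¬ LinearMap.ker ((SbC K 1 lam 0 1 - 1) ^ j) ≤ LinearMap.ker (e ^ j) := by
  intro hle
  have h := finrank_ker_pow_raising_eq_finrank_ker_pow_shear_charP K hE hEtop p hlam j
  have heq := Submodule.eq_of_le_of_finrank_eq hle h.symm
  exact not_ker_pow_raising_le_ker_shear_sub_one_pow K hE p hlam hn hj1 hjp heq.symm.le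

omit hEtop in
/-- **`n ≥ 2p − 1 ⇒ ker e^j ≠ ker (S_λ − 1)^j`** for `1 ≤ j < p`. -/
theorem ker_pow_raising_ne_ker_shear_sub_one_pow_of_ge (p : ℕ) [Fact p.Prime] [CharP K p] {lam : K} (hlam : lam ≠ 0) (hn : 2 * p - 1 ≤ n) {j : ℕ} (hj1 : 1 ≤ j)
    (hjp : j < p) : LinearMap.ker (e ^ j) ≠ LinearMap.ker ((SbC K 1 lam 0 1 - 1) ^ j) :=
  fun h => not_ker_pow_raising_le_ker_shear_sub_one_pow K hE p hlam hn hj1 hjp h.le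

/-- **SAME JORDAN TYPE, DIFFERENT FLAGS, EVERY POWER: for `1 ≤ j < p`, `ker e^j = ker (S_λ − 1)^j ↔ n ≤ 2p − 2`** (`λ ≠ 0`, characteristic `p`) — the threshold of M6 (`j = 1`)
is the threshold for every proper member of the kernel flag. -/
theorem ker_pow_raising_eq_ker_shear_sub_one_pow_iff (p : ℕ) [Fact p.Prime] [CharP K p] {lam : K} (hlam : lam ≠ 0) {j : ℕ} (hj1 : 1 ≤ j) (hjp : j < p) :
    LinearMap.ker (e ^ j) = LinearMap.ker ((SbC K 1 lam 0 1 - 1) ^ j) ↔ n ≤ 2 * p - 2 :=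
  ⟨fun h => by
    by_contra hn
    exact ker_pow_raising_ne_ker_shear_sub_one_pow_of_ge K hE p hlam (by omega) hj1 hjp h,
   fun hn => ker_pow_raising_eq_ker_shear_sub_one_pow_of_le K hE hEtop p hlam hn j⟩

/-- `p ≤ j ⇒ ker e^j = ⊤` (the nilpotency index of `e` is `min(p, n+1) ≤ p`, K43). -/
theorem ker_pow_raising_eq_top_of_prime_le (p : ℕ) [Fact p.Prime] [CharP K p] {j : ℕ} (hpj : p ≤ j) : LinearMap.ker (e ^ j) = ⊤ := by
  rw [(raising_pow_eq_zero_iff_charP K hE hEtop p j).mpr (le_trans (min_le_left _ _) hpj), LinearMap.ker_zero]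

/-- **THE COMPLETE ANSWER: `ker e^j = ker (S_λ − 1)^j ↔ j = 0 ∨ p ≤ j ∨ n ≤ 2p − 2`** (`λ ≠ 0`, characteristic `p`, every `n`, every `j`). -/
theorem ker_pow_raising_eq_ker_shear_sub_one_pow_iff' (p : ℕ) [Fact p.Prime] [CharP K p] {lam : K} (hlam : lam ≠ 0) (j : ℕ) :
    LinearMap.ker (e ^ j) = LinearMap.ker ((SbC K 1 lam 0 1 - 1) ^ j) ↔ j = 0 ∨ p ≤ j ∨ n ≤ 2 * p - 2 := by
  constructor
  · intro h
    by_contra hc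
    simp only [not_or, not_le] at hc
    exact ker_pow_raising_ne_ker_shear_sub_one_pow_of_ge K hE p hlam (by omega) (by omega) hc.2.1 h
  · rintro (rfl | hpj | hn)
    · rw [pow_zero, pow_zero]
    · rw [ker_pow_raising_eq_top_of_prime_le K hE hEtop p hpj, ker_shear_sub_one_pow_eq_top_of_prime_le K p hlam hpj]
    · exact ker_pow_raising_eq_ker_shear_sub_one_pow_of_le K hE hEtop p hlam hn j

end RaisingShearPow

end Summit.Ventures.HSemireg.Wedge.HankelFrameChange
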